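import Summits.CriticalPhenomena.PercolationContinuityZ3.Theorems.PercNearOneGluingNoHeavyLowerTailCILStrongRelayNeighbours
import Summits.CriticalPhenomena.PercolationContinuityZ3.Theorems.PercNearOneGluingNoHeavyLowerTailCILPortDomination
import HarnessLib

/-!
# `NoHeavyLowerTail` (stmt-CriticalPhenomena-4575) — hull-port line: the FIRST-ATTACHED-LIGHT bound for two observers

Support file (prover `prim-hp-1`, hull-port / coupling line; `--supports stmt-CriticalPhenomena-4575`).  No definitions, no named
facts, no sorries.

Setting: `μ = prodBernoulli w` on `Fin n`, relays `A`, level `j`, `π(v) = {x ∈ A : v ↔ x}`.  Two observers `x₁, x₂ ∉ A` whose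
positive-weight neighbours are relays: the ports `p 0, …, p (d−1)` of `x₁` and `q 0, …, q (d'−1)` of `x₂` (injective lists of relays;
weight-`0` ports may be listed, so any relay can be made a port of `x₁`).  `x₁` is ATTACHED when some port edge `s(x₁, p l)` is open,
and attached-light when `1 ≤ |π(x₁)| ≤ j`.  `H = G − x₁` is read on `ω ∩ {e | x₁ ∉ e}`.

* `HullPort.firstAttachedLight_le` — if the port `p i` of `x₁` is at least as `H`-light as every port of `x₁` and of `x₂`, then

      μ{1 ≤ |π(x₁)| ≤ j} + μ({no port edge of x₁ open} ∩ {1 ≤ |π(x₂)| ≤ j}) ≤ μ{|π(p i)| ≤ j}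

  ("the first attached observer, in the order `x₁, x₂`, is light" is at most as likely as "`p i` is light").  In particular the
  left side is at most the largest port lightness (crux memo HULLPORT-COUPLING.md §22: census 0 / 4 700, both orders; the bound
  sits between the one-observer CIL and the open two-observer atom, and is the provable half of hp-6's HP-SQG(|U| = 2)).
  Proof: `lightnessSlack_relayNeighbours` (prover `prim-hp-2`: strong first-open-port CIL at `x₁`, slack = all-ports-closed
  mass × `H`-lightness of `p i`) + independence of the port edges of `x₁` from `H` + `cil_of_portDomination` for `x₂` in `H`
  (transported by `CutObserver.measureReal_preimage_avoid`).
[cite: VandenbergHaggstromKahn2005, Thm. 1.5 (p. 7) — the only probabilistic input, through the two tree lemmas]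
-/

noncomputable section

namespace Summit.CriticalPhenomena.PercolationContinuityZ3.Theorems

open MeasureTheory Set Literature.Probability.LatticeModels Literature.Probability.Percolation
open scoped Classical BigOperators

variable {n : ℕ}

namespace HullPort

open CutObserver in
/-- **First-attached-light bound.**  For two relay-neighboured observers `x₁, x₂ ∉ A` (ports `p` of `x₁`, `q` of `x₂`) and a
port `p i` of `x₁` that is at least as `H = G − x₁`-light as every port of `x₁` and of `x₂`:
`μ{1 ≤ |π(x₁)| ≤ j} + μ({∀ l, s(x₁, p l) ∉ ω} ∩ {1 ≤ |π(x₂)| ≤ j}) ≤ μ{|π(p i)| ≤ j}`.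
[cite: VandenbergHaggstromKahn2005, Thm. 1.5 (p. 7) — via `lightnessSlack_relayNeighbours` and `cil_of_portDomination`] -/
theorem firstAttachedLight_le (w : Sym2 (Fin n) → unitInterval) (A : Finset (Fin n)) (x₁ x₂ : Fin n) (j : ℕ) {d d' : ℕ}
    (p : Fin d → Fin n) (hp : Function.Injective p) (hpA : ∀ l, p l ∈ A) (hx₁A : x₁ ∉ A)
    (hobs₁ : ∀ v, w s(x₁, v) ≠ 0 → ∃ l, v = p l)
    (q : Fin d' → Fin n) (hq : Function.Injective q) (hqA : ∀ l, q l ∈ A) (hx₂A : x₂ ∉ A) (hd' : 0 < d')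
    (hobs₂ : ∀ v, w s(x₂, v) ≠ 0 → ∃ l, v = q l) (i : Fin d)
    (hdom₁ : ∀ l : Fin d,
      (prodBernoulli w).real {ω : BondConfig (Fin n) |
          (A.filter fun x => (openGraph (ω ∩ {e | x₁ ∉ e})).Reachable (p l) x).card ≤ j} ≤
        (prodBernoulli w).real {ω : BondConfig (Fin n) |
          (A.filter fun x => (openGraph (ω ∩ {e | x₁ ∉ e})).Reachable (p i) x).card ≤ j})
    (hdom₂ : ∀ l : Fin d',
      (prodBernoulli w).real {ω : BondConfig (Fin n) |
          (A.filter fun x => (openGraph (ω ∩ {e | x₁ ∉ e})).Reachable (q l) x).card ≤ j} ≤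
        (prodBernoulli w).real {ω : BondConfig (Fin n) |
          (A.filter fun x => (openGraph (ω ∩ {e | x₁ ∉ e})).Reachable (p i) x).card ≤ j}) :
    (prodBernoulli w).real {ω : BondConfig (Fin n) |
        1 ≤ (A.filter fun x => ω ∈ openConn x₁ x).card ∧ (A.filter fun x => ω ∈ openConn x₁ x).card ≤ j} +
      (prodBernoulli w).real ({ω : BondConfig (Fin n) | ∀ l, s(x₁, p l) ∉ ω} ∩
        {ω | 1 ≤ (A.filter fun x => ω ∈ openConn x₂ x).card ∧ (A.filter fun x => ω ∈ openConn x₂ x).card ≤ j}) ≤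
      (prodBernoulli w).real {ω : BondConfig (Fin n) | (A.filter fun x => ω ∈ openConn (p i) x).card ≤ j} := by
  set μ := prodBernoulli w with hμ
  haveI : IsProbabilityMeasure μ := by rw [hμ]; infer_instance
  -- notation
  set C := {ω : BondConfig (Fin n) | ∀ l, s(x₁, p l) ∉ ω} with hC
  set TH := {ω : BondConfig (Fin n) |
    (A.filter fun x => (openGraph (ω ∩ {e | x₁ ∉ e})).Reachable (p i) x).card ≤ j} with hTH
  set L₂ := {ω : BondConfig (Fin n) |
    1 ≤ (A.filter fun x => ω ∈ openConn x₂ x).card ∧ (A.filter fun x => ω ∈ openConn x₂ x).card ≤ j} with hL₂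
  set L₂H := {ω : BondConfig (Fin n) |
    1 ≤ (A.filter fun x => (openGraph (ω ∩ {e | x₁ ∉ e})).Reachable x₂ x).card ∧
      (A.filter fun x => (openGraph (ω ∩ {e | x₁ ∉ e})).Reachable x₂ x).card ≤ j} with hL₂H
  set G := {ω : BondConfig (Fin n) | ∀ e ∈ ω, w e ≠ 0} with hG
  -- (1) the strong CIL at `x₁` with its slack
  have hslack := lightnessSlack_relayNeighbours w A x₁ j p hp hpA hx₁A hobs₁ i hdom₁
  -- (2) on `C ∩ G` no open edge contains `x₁`, so the cluster of `x₂` is its `H`-cluster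
  have hωH : ∀ ω, ω ∈ C → ω ∈ G → ω ∩ {e | x₁ ∉ e} = ω := by
    intro ω hCω hGω
    ext e
    simp only [mem_inter_iff, mem_setOf_eq, and_iff_left_iff_imp]
    intro he hx
    have hne := hGω e he
    induction e using Sym2.ind with
    | h a b =>
      rcases Sym2.mem_iff.1 hx with rfl | rfl
      · obtain ⟨l, rfl⟩ := hobs₁ b hne
        exact hCω l he
      · have hne' : w s(x₁, a) ≠ 0 := by rw [Sym2.eq_swap]; exact hne
        obtain ⟨l, rfl⟩ := hobs₁ a hne'
        exact hCω l (by rw [Sym2.eq_swap]; exact he)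
  have hCL : (C ∩ L₂) ∩ G = (C ∩ L₂H) ∩ G := by
    ext ω
    simp only [mem_inter_iff]
    constructor
    · rintro ⟨⟨hCω, hLω⟩, hGω⟩
      refine ⟨⟨hCω, ?_⟩, hGω⟩
      simp only [hL₂H, mem_setOf_eq, hωH ω hCω hGω]
      simpa only [hL₂, mem_setOf_eq, openConn] using hLω
    · rintro ⟨⟨hCω, hLω⟩, hGω⟩
      refine ⟨⟨hCω, ?_⟩, hGω⟩
      simp only [hL₂H, mem_setOf_eq, hωH ω hCω hGω] at hLω
      simpa only [hL₂, mem_setOf_eq, openConn] using hLω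
  -- (3) independence of `C` (port edges of `x₁`) and `L₂H` (edges off `x₁`)
  set Ports : Finset (Sym2 (Fin n)) := Finset.univ.image fun l : Fin d => s(x₁, p l) with hPorts
  set Eo : Finset (Sym2 (Fin n)) := Finset.univ.filter fun e : Sym2 (Fin n) => x₁ ∉ e with hEo
  have hdisj : Disjoint Ports Eo := by
    rw [Finset.disjoint_left]; intro e he he'
    rw [hPorts, Finset.mem_image] at he; obtain ⟨l, -, rfl⟩ := he
    rw [hEo, Finset.mem_filter] at he'; exact he'.2 (Sym2.mem_mk_left _ _)
  have hC_det : DeterminedBy C (↑Ports : Set (Sym2 (Fin n))) := by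
    rw [determinedBy_iff]
    intro ω ω' h
    simp only [hC, mem_setOf_eq]
    refine forall_congr' fun l => ?_
    have hmem : s(x₁, p l) ∈ (↑Ports : Set (Sym2 (Fin n))) := by
      rw [Finset.mem_coe, hPorts, Finset.mem_image]; exact ⟨l, by simp, rfl⟩
    have := Set.ext_iff.1 h (s(x₁, p l))
    simp only [mem_inter_iff, hmem, and_true] at this
    rw [this]
  have hL₂H_det : DeterminedBy L₂H (↑Eo : Set (Sym2 (Fin n))) := by
    have h := determinedBy_restrict Eo (fun ξ =>
      1 ≤ (A.filter fun x => (openGraph ξ).Reachable x₂ x).card ∧ (A.filter fun x => (openGraph ξ).Reachable x₂ x).card ≤ j)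
    rw [coe_edgesAvoiding] at h
    rw [hEo, coe_edgesAvoiding]; exact h
  have hind : μ.real (C ∩ L₂H) = μ.real C * μ.real L₂H :=
    prodBernoulli_real_inter_of_determinedBy_disjoint w hdisj hC_det hL₂H_det MeasurableSet.of_discrete
      MeasurableSet.of_discrete
  have h2 : μ.real (C ∩ L₂) = μ.real C * μ.real L₂H := by
    rw [← measureReal_inter_support w (C ∩ L₂), hCL, measureReal_inter_support, hind]
  -- (4) CIL for `x₂` in `H`: transport to the weights with the edges at `x₁` switched off
  have hcil : μ.real L₂H ≤ μ.real TH := by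
    set u : Sym2 (Fin n) → unitInterval := fun e => if e ∈ {e : Sym2 (Fin n) | x₁ ∉ e} then w e else 0 with hu
    set Lx := {ξ : BondConfig (Fin n) |
      1 ≤ (A.filter fun y => ξ ∈ openConn x₂ y).card ∧ (A.filter fun y => ξ ∈ openConn x₂ y).card ≤ j} with hLx
    set Tb := {ξ : BondConfig (Fin n) | (A.filter fun y => ξ ∈ openConn (p i) y).card ≤ j} with hTb
    have eL : L₂H = {ω : BondConfig (Fin n) | ω ∩ {e | x₁ ∉ e} ∈ Lx} := by
      ext ω; simp only [hL₂H, hLx, mem_setOf_eq, openConn]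
    have eT : TH = {ω : BondConfig (Fin n) | ω ∩ {e | x₁ ∉ e} ∈ Tb} := by
      ext ω; simp only [hTH, hTb, mem_setOf_eq, openConn]
    rw [eL, eT, measureReal_preimage_avoid, measureReal_preimage_avoid]
    change (prodBernoulli u).real Lx ≤ (prodBernoulli u).real Tb
    have hux : ∀ v, u s(x₂, v) ≠ 0 → w s(x₂, v) ≠ 0 := by
      intro v hv
      by_cases hmem : s(x₂, v) ∈ {e : Sym2 (Fin n) | x₁ ∉ e}
      · simpa only [hu, hmem, if_true] using hv
      · simp only [hu, hmem, if_false, ne_eq, not_true_eq_false] at hv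
    have hobs₂' : ∀ v, u s(x₂, v) ≠ 0 → ∃ l, v = q l := fun v hv => hobs₂ v (hux v hv)
    have hdom₂' : ∀ l : Fin d',
        (prodBernoulli u).real {ξ : BondConfig (Fin n) | (A.filter fun y => ξ ∈ openConn (q l) y).card ≤ j} ≤
          (prodBernoulli u).real {ξ : BondConfig (Fin n) | (A.filter fun y => ξ ∈ openConn (p i) y).card ≤ j} := by
      intro l
      have h := hdom₂ l
      have e2 : ∀ z : Fin n, {ω : BondConfig (Fin n) |
          (A.filter fun x => (openGraph (ω ∩ {e | x₁ ∉ e})).Reachable z x).card ≤ j} =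
          {ω : BondConfig (Fin n) | ω ∩ {e | x₁ ∉ e} ∈
            {ξ : BondConfig (Fin n) | (A.filter fun y => ξ ∈ openConn z y).card ≤ j}} := by
        intro z; ext ω; simp only [mem_setOf_eq, openConn]
      rw [e2 (q l), eT, measureReal_preimage_avoid, measureReal_preimage_avoid] at h
      exact h
    exact cil_of_portDomination u A x₂ j q hq hqA hx₂A hd' hobs₂' (p i) hdom₂'
  -- (5) assemble
  have h3 : μ.real (C ∩ L₂) ≤ μ.real C * μ.real TH := by
    rw [h2]; exact mul_le_mul_of_nonneg_left hcil measureReal_nonneg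
  linarith [hslack, h3]

end HullPort

end Summit.CriticalPhenomena.PercolationContinuityZ3.Theorems

end
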